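import Summits.ResolutionOfSingularities.ResolutionOfSingularities.Theorems.PurelyInseparableDim4IsolatedHasseContact
import Summits.ResolutionOfSingularities.ResolutionOfSingularities.Theorems.PurelyInseparableDim4ResConeLedgerLinear
import HarnessLib
import HarnessLib.Audit.Tags

/-!
# Purely inseparable four-folds — THE LEVEL-2 SEED: a two-letter ledger `u·G = S·x_a x_{b′} + T·h^d`
# forces `ord S ≥ d − 1` and `T(0)·κ^d = u(0)·a₀` (K2(p) lane, slice B, memo v1.4 §9 (K16); cell `res-dim4-pi`)

[OURS · counted 0 · cell `res-dim4-pi` · K2(p) lane holder res-dim4-p-12 g3's SLICE-B KERNEL ARCHITECTURE MEMO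
v1.4 §9 (K7-prep, light regime), brick (K16) by the holder's signature (2026-08-28 23:57Z), seat res-dim4-p-3 g3.]
Pure algebra in `K[x₀, …, x₃]`; nothing here proves K2(p), `NoIsolatedTrap p p` or resolution of singularities in
dimension ≥ 4 / characteristic `p`.  AI kernel work, weaker than expert review.

At a KILL state of a slice-B stretch two stretch-born boundary letters `a ≠ b′` carry the merged ledger
`u·G = S·(x_a x_{b′}) + T·h^d` (K1/K2/K8), the residual has `ord G ≥ d` with power cone `in_d G = a₀·L^d` and the
contact polynomial has `lin h = κ·L` (K9).  The LEVEL-2 OBJECT of I-4-7's C∞ class («Ã₀, ord 3, x_new ∣ Ã₀′») is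
the cofactor `S`; this file seeds its ledger:
* `homogeneousComponent_one_hasseDeriv_powerCone` — the linear part of the Hasse contact polynomial
  `D_e^{(d−1)} G` of a power cone is `a₀·d·ℓ_e^{d−1}·L` (glue `IsolatedBand.coeff_single_hasseDeriv_powerCone`,
  coefficientwise).
* **`levelTwo_seed`** — `ord S ≥ d − 1` AND `T(0)·κ^d = u(0)·a₀`: the three terms have order `≥ d`, so
  `ord S ≥ d − 2`; in degree `d`, `x_a x_{b′}·in_{d−2} S = (u(0) a₀ − T(0) κ^d)·L^d`
  (`ResCone.homogeneousComponent_mul_of_le_ordZero`, K9), and the monomial `x_e^d` (`e ≠ b′`, `ℓ_e ≠ 0`) occurs on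
  the right with coefficient `(u(0) a₀ − T(0) κ^d)·ℓ_e^d` (cf. the tree's
  `Literature.RingTheory.AlgebraicIndependent.coeff_single_linearForm_pow`; read here through `D_e^{(d)}` to keep
  the import closure inside the lane) but not on the left — so BOTH sides vanish.
bears_on: LADDER-RESOLUTION:D157-DOOR2 (res-dim4-pi · K2(p) · slice B (K16)).  Supports
stmt-ResolutionOfSingularities-16155 (helper).
-/

set_option linter.dupNamespace false -- mandated namespace of this single-conjunct summit

noncomputable section

namespace Summit.ResolutionOfSingularities.ResolutionOfSingularities.Theorems.PIDim4

namespace ResCone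

open MvPolynomial Finset
open Literature.AlgebraicGeometry.Resolution
open Literature.AlgebraicGeometry.Resolution.Hauser2010

variable {K : Type} [Field K]

/-! ## 1. The linear part of the Hasse contact polynomial of a power cone -/

/-- **`lin (D_e^{(d−1)} G) = a₀·d·ℓ_e^{d−1}·L`** for a residual `G` whose degree-`d` component is the power cone
`a₀·L^d`, `L = Σ ℓ_i x_i`, `1 ≤ d` (coefficientwise this is `IsolatedBand.coeff_single_hasseDeriv_powerCone`).
[OURS] [folklore] -/
theorem homogeneousComponent_one_hasseDeriv_powerCone (e : Fin 4) {G : MvPolynomial (Fin 4) K} {d : ℕ}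
    (hd : 1 ≤ d) {a₀ : K} {ℓ : Fin 4 → K}
    (hcone : homogeneousComponent d G = C a₀ * (∑ i, C (ℓ i) * X i) ^ d) :
    homogeneousComponent 1 (hasseDeriv (Finsupp.single e (d - 1)) G) =
      C (a₀ * d * ℓ e ^ (d - 1)) * ∑ i, C (ℓ i) * X i := by
  classical
  ext m
  rw [coeff_homogeneousComponent, coeff_C_mul]
  by_cases hm : m.degree = 1
  · rw [if_pos hm]
    have hm0 : m ≠ 0 := fun h0 => by rw [h0, map_zero] at hm; exact absurd hm (by decide)
    obtain ⟨i, hi⟩ := Finset.nonempty_iff_ne_empty.mpr (mt Finsupp.support_eq_empty.mp hm0)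
    rw [eq_single_of_degree_eq_one hm (Finsupp.mem_support_iff.mp hi),
      IsolatedBand.coeff_single_hasseDeriv_powerCone e i hd hcone, coeff_single_linearForm]
  · rw [if_neg hm, (isHomogeneous_linearForm ℓ).coeff_eq_zero hm, mul_zero]

/-! ## 2. The level-2 seed -/

/-- Degrees `≥ n` on the support give `n ≤ ord₀`. [folklore] -/
theorem natCast_le_ordZero_of_forall_le_degree {P : MvPolynomial (Fin 4) K} {n : ℕ}
    (hP : ∀ m ∈ P.support, n ≤ m.degree) : (n : ℕ∞) ≤ ordZero P :=
  Literature.Barriers.ResolutionOfSingularities.le_ordZero_of_forall P n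
    fun m hm => hP m (MvPolynomial.mem_support_iff.mpr hm)

/-- **THE LEVEL-2 SEED** (memo v1.4 §9 (K16); I-4-7 C∞ «Ã₀, ord 3»): from the merged two-letter ledger
`u·G = S·(x_a x_{b′}) + T·h^d` with `h ∈ 𝔪₀`, `ord G ≥ d ≥ 2`, power cone `in_d G = a₀·L^d`, contact linear
part `lin h = κ·L`, and a letter `e ≠ b′` with `ℓ_e ≠ 0`: the cofactor has `ord S ≥ d − 1` and
`T(0)·κ^d = u(0)·a₀`. [OURS] [folklore] -/
theorem levelTwo_seed {a b' : Fin 4} {G h u S T : MvPolynomial (Fin 4) K} {d : ℕ} (hd : 2 ≤ d)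
    (hG : u * G = S * (X a * X b') + T * h ^ d) (hh : h ∈ originIdeal K)
    (hordG : ∀ m ∈ G.support, d ≤ m.degree) {a₀ κ : K} {ℓ : Fin 4 → K}
    (hcone : homogeneousComponent d G = C a₀ * (∑ i, C (ℓ i) * X i) ^ d)
    (hlin : homogeneousComponent 1 h = C κ * (∑ i, C (ℓ i) * X i)) {e : Fin 4} (heb : e ≠ b')
    (he : ℓ e ≠ 0) :
    (∀ m ∈ S.support, d - 1 ≤ m.degree) ∧ MvPolynomial.eval 0 T * κ ^ d = MvPolynomial.eval 0 u * a₀ := by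
  classical
  have hh0 : constantCoeff h = 0 := (NarrowApolarity.mem_originIdeal_iff h).mp hh
  -- orders
  have hoG : (d : ℕ∞) ≤ ordZero G := natCast_le_ordZero_of_forall_le_degree hordG
  have hohd : (d : ℕ∞) ≤ ordZero (h ^ d) := le_ordZero_pow_of_constantCoeff_eq_zero hh0 d
  have hoh : ((1 : ℕ) : ℕ∞) ≤ ordZero h := by rw [Nat.cast_one, one_le_ordZero_iff]; exact hh0
  have h0u : ((0 : ℕ) : ℕ∞) ≤ ordZero u := by simp
  have h0T : ((0 : ℕ) : ℕ∞) ≤ ordZero T := by simp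
  have hoSX : (d : ℕ∞) ≤ ordZero (S * (X a * X b')) := by
    rw [show S * (X a * X b') = u * G - T * h ^ d from eq_sub_of_add_eq hG.symm]
    exact le_ordZero_sub (hoG.trans (le_ordZero_mul_left u G)) (hohd.trans (le_ordZero_mul_left T (h ^ d)))
  -- `ord S ≥ d − 2`, through the coefficients
  have hoS : (((d - 2 : ℕ)) : ℕ∞) ≤ ordZero S := by
    rw [natCast_le_ordZero_iff_forall_coeff]
    intro m hm
    have h1 : coeff (m + (Finsupp.single a 1 + Finsupp.single b' 1)) (S * (X a * X b')) = 0 := by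
      refine coeff_eq_zero_of_degree_lt_ordZero (lt_of_lt_of_le ?_ hoSX)
      rw [map_add, map_add, Finsupp.degree_single, Finsupp.degree_single]
      exact_mod_cast (show m.degree + (1 + 1) < d by omega)
    rwa [show (X a * X b' : MvPolynomial (Fin 4) K) = monomial (Finsupp.single a 1 + Finsupp.single b' 1) 1 by
      rw [X, X, monomial_mul, one_mul], coeff_mul_monomial', if_pos le_add_self, add_tsub_cancel_right,
      mul_one] at h1
  have h2X : ((2 : ℕ) : ℕ∞) ≤ ordZero (X a * X b' : MvPolynomial (Fin 4) K) := by
    rw [ordZero_mul, ordZero_X, ordZero_X]; norm_num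
  -- degree-`d` components of the ledger identity
  have hXab : homogeneousComponent 2 (X a * X b' : MvPolynomial (Fin 4) K) = X a * X b' :=
    homogeneousComponent_eq_self ((isHomogeneous_X K a).mul (isHomogeneous_X K b'))
  have hcomp : C (constantCoeff u) * (C a₀ * (∑ i, C (ℓ i) * X i) ^ d) =
      homogeneousComponent (d - 2) S * (X a * X b') + C (constantCoeff T) * (C κ * ∑ i, C (ℓ i) * X i) ^ d := by
    have h1 := congrArg (homogeneousComponent d) hG
    have huG := homogeneousComponent_mul_of_le_ordZero h0u hoG
    have hSX := homogeneousComponent_mul_of_le_ordZero hoS h2X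
    have hTh := homogeneousComponent_mul_of_le_ordZero h0T hohd
    have hpow := homogeneousComponent_pow_of_le_ordZero hoh d
    rw [zero_add] at huG hTh
    rw [mul_one] at hpow
    rw [show d - 2 + 2 = d by omega] at hSX
    rw [map_add, huG, hSX, hTh, hpow, hcone, hlin, hXab, homogeneousComponent_zero, homogeneousComponent_zero] at h1
    simpa only [← constantCoeff_eq] using h1
  -- read the coefficient of `x_e^d`
  have hkey : homogeneousComponent (d - 2) S * (X a * X b') =
      C (constantCoeff u * a₀ - constantCoeff T * κ ^ d) * (∑ i, C (ℓ i) * X i) ^ d := by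
    rw [map_sub, sub_mul, map_mul, map_mul, map_pow, mul_assoc, hcomp, mul_pow, ← C_pow]
    ring
  -- the `x_e^d`-coefficient of `L^d` is `ℓ_e^d` (the tree's
  -- `Literature.RingTheory.AlgebraicIndependent.coeff_single_linearForm_pow`, read here through `D_e^{(d)}`)
  have hLd : coeff (Finsupp.single e d) ((∑ i, C (ℓ i) * X i : MvPolynomial (Fin 4) K) ^ d) = ℓ e ^ d := by
    have h1 := IsolatedBand.coeff_hasseDeriv_single' e d ((∑ i, C (ℓ i) * X i : MvPolynomial (Fin 4) K) ^ d) 0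
    rw [Finsupp.coe_zero, Pi.zero_apply, zero_add, Nat.choose_self, Nat.cast_one, one_mul, zero_add,
      IsolatedBand.hasseDeriv_single_linearForm_pow, Nat.choose_self, Nat.cast_one, one_mul, Nat.sub_self,
      pow_zero, mul_one, coeff_C, if_pos rfl] at h1
    exact h1.symm
  have hcoef : constantCoeff u * a₀ - constantCoeff T * κ ^ d = 0 := by
    have h1 := congrArg (coeff (Finsupp.single e d)) hkey
    rw [coeff_C_mul, hLd, ← mul_assoc, coeff_mul_X', if_neg] at h1
    · exact (mul_eq_zero.mp h1.symm).resolve_right (pow_ne_zero _ he)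
    · rw [Finsupp.mem_support_iff, Finsupp.single_eq_of_ne (Ne.symm heb)]; exact fun h => h rfl
  have hS2 : homogeneousComponent (d - 2) S = 0 := by
    rw [hcoef, C_0, zero_mul, mul_eq_zero] at hkey
    exact hkey.resolve_right (mul_ne_zero (X_ne_zero a) (X_ne_zero b'))
  refine ⟨fun m hm => ?_, ?_⟩
  · have h1 : d - 2 ≤ m.degree := by
      by_contra hlt
      exact (MvPolynomial.mem_support_iff.mp hm)
        (coeff_eq_zero_of_degree_lt_ordZero (lt_of_lt_of_le (by exact_mod_cast (show m.degree < d - 2 by omega)) hoS))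
    by_contra hlt
    have hdeg : m.degree = d - 2 := by omega
    have h2 := congrArg (coeff m) hS2
    rw [coeff_homogeneousComponent, if_pos hdeg, coeff_zero] at h2
    exact (MvPolynomial.mem_support_iff.mp hm) h2
  · rw [MvPolynomial.eval_zero]
    exact (sub_eq_zero.mp hcoef).symm

end ResCone

end Summit.ResolutionOfSingularities.ResolutionOfSingularities.Theorems.PIDim4

end
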